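import Literature.Probability.LatticeModels.VillainPathEstimator
import Literature.Probability.LatticeModels.GarbanSpencerXYLongRangeOrderProofs
import HarnessLib

/-!
# Long-range order of the classical Villain model in `d ≥ 3`, free boundary condition and beyond
# (Garban–Spencer 2022, Theorem 1.3 with Remarks 1 and 10)

C. Garban, T. Spencer, *Continuous symmetry breaking along the Nishimori line*, J. Math. Phys.
**63** (2022) 093302 = arXiv:2109.01617.  Theorem 1.3 with Remark 1 gives long-range order of the
classical XY model in `d ≥ 3` on arbitrary finite `Λ ⊂ ℤ^d` with free boundary condition, without
reflection positivity; Remark 10: "the proof extends verbatim to the Villain interaction".  The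
tree PROVES the XY statement (`GarbanSpencer2022_xyLongRangeOrder_holds`).  This file PROVES the
Villain statement, in the slightly more flexible form the proof actually gives and which periodic
boundary conditions need: the path ensemble of `ℤ^d` (the tree's ball paths `Frame.chainOf`,
`UnpredictablePairTails`) is pushed forward along any embedding of the bond system of `Λ` into a
finite bond system `G'` (`BondSystem.Embedding`, `UnitChain.map`), and the estimator bound
(`VillainPathEstimator`) is applied on `G'`:

* `villain_longRangeOrder` — for `d ≥ 3` there are `K_c, a > 0` with
  `⟨cos(θ(ιx) − θ(ιy))⟩^{Villain}_{G',K} ≥ 1 − √(a log K / K)` for all `K ≥ K_c`, all finite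
  `Λ ⊂ ℤ^d`, all `G'` with an embedding `ι` of `latticeBonds Λ`, and all `x, y ∈ Λ` with
  `B((x+y)/2, 2‖x−y‖₂) ∩ ℤ^d ⊂ Λ` (constants `a = 96(d+2)L`, `K_c = 32(d+2)L`, `L` the tail scale of
  `card_meetCount_ge_le`; `λ_K^{-2} = e^{1/K} ≤ 1 + 2/K` replaces the von Mises bound).

Used for `Summit.AtomisticToContinuum.BoseEinsteinCondensation.Theses.BECStoquasticCensoring.HomogeneousVillainLRO`
(equal-time long-range order of the (3+1)-dimensional Villain current model on a space-time
torus, via the worm representation).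

## References

* C. Garban, T. Spencer, J. Math. Phys. 63 (2022) 093302, arXiv:2109.01617: Theorem 1.3,
  Remark 1, Remark 10, Lemma 2.5, proof of Theorem 1.3 Steps 1–2. [GarbanSpencer2022]
-/

noncomputable section

namespace Literature.Probability.LatticeModels

open MeasureTheory Finset TopologicalSpace Filter
open scoped BigOperators ComplexConjugate Topology
open Literature.MathematicalPhysics.QuantumFieldTheory
open BallPath DyadicWalk Trail

/-! ### Long-range order of the Villain model in `d ≥ 3` on any graph containing a lattice ball -/

/-- `(λ_K²)⁻¹ = e^{1/K}`. [folklore] -/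
theorem inv_villainMean_sq (K : ℝ) : ((villainMean K) ^ 2)⁻¹ = Real.exp (1 / K) := by
  rw [villainMean, ← Real.exp_nat_mul, ← Real.exp_neg]
  congr 1
  push_cast
  ring

/-- `(λ_K²)⁻¹ ≤ 1 + 2/K` for `K ≥ 1` (`e^t ≤ 1 + 2t` on `[0,1]`). [folklore] -/
theorem inv_villainMean_sq_le {K : ℝ} (hK : 1 ≤ K) : ((villainMean K) ^ 2)⁻¹ ≤ 1 + 2 / K := by
  rw [inv_villainMean_sq]
  have hK0 : 0 < K := by linarith
  have h1 : |(1 / K : ℝ)| ≤ 1 := by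
    rw [abs_of_nonneg (by positivity), div_le_one hK0]; exact hK
  have h2 := Real.abs_exp_sub_one_le h1
  rw [abs_of_nonneg (by positivity : (0 : ℝ) ≤ 1 / K)] at h2
  have h3 := (abs_le.1 h2).2
  have h4 : (2 : ℝ) * (1 / K) = 2 / K := by ring
  linarith

/-- **Long-range order of the classical Villain model in `d ≥ 3` without reflection positivity
(Garban–Spencer 2022, Theorem 1.3 with Remarks 1 and 10), on an arbitrary finite graph containing
a copy of a lattice domain.**  Let `d ≥ 3`.  There are `K_c, a > 0` such that for every stiffness
`K ≥ K_c`, every finite `Λ ⊂ ℤ^d`, every finite bond system `G'` together with an embedding of the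
free-boundary bond system of `Λ` (`latticeBonds Λ`) into `G'` (vertex map `ι`, bonds of `Λ`
mapped injectively onto bonds of `G'` up to orientation — e.g. `G'` a discrete torus and `Λ` a box
in one of its coordinate slices; the other bonds of `G'` are arbitrary), and all `x, y ∈ Λ` with
`B((x+y)/2, 2‖x−y‖₂) ∩ ℤ^d ⊂ Λ`:
`⟨cos(θ(ιx) − θ(ιy))⟩^{Villain}_{G',K} ≥ 1 − √(a log K / K)`.
The printed theorem is the XY case on `latticeBonds Λ` itself (proved in the tree as
`GarbanSpencer2022_xyLongRangeOrder_holds`); Remark 10 of the source records the extension to the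
Villain interaction, and the proof (Nishimori gauge identity, path estimator over the tree's
ball-path ensembles, MMP inequality) runs on any bond system into which the ensemble is pushed
forward, which is the form needed for periodic boundary conditions.
[cite: GarbanSpencer2022, Theorem 1.3 with Remark 1 and Remark 10] -/
theorem villain_longRangeOrder (d : ℕ) (hd : 3 ≤ d) :
    ∃ Kc a : ℝ, 0 < Kc ∧ 0 < a ∧ ∀ K : ℝ, Kc ≤ K →
      ∀ (Λ : Finset (Site d)) (V' ι' : Type) [Fintype V'] [Fintype ι'] (G' : BondSystem V' ι')
        (e : (latticeBonds Λ).Embedding G') (x y : Site d) (hx : x ∈ Λ) (hy : y ∈ Λ),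
        (∀ z : Site d,
          (∑ i, ((z i : ℝ) - ((x i : ℝ) + (y i : ℝ)) / 2) ^ 2) ≤ 4 * ∑ i, ((x i : ℝ) - (y i : ℝ)) ^ 2 →
            z ∈ Λ) →
        1 - Real.sqrt (a * Real.log K / K) ≤
          G'.villainExpect K 1 (cosDiff (e.vmap ⟨x, hx⟩) (e.vmap ⟨y, hy⟩)) := by
  obtain ⟨L, hL, htail⟩ := card_meetCount_ge_le
  -- constants
  set c : ℕ := 2 * (d + 2) with hc
  have hc1 : (1 : ℝ) ≤ c := by rw [hc]; push_cast; linarith [show (0:ℝ) ≤ d from Nat.cast_nonneg d]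
  have hL1 : (1 : ℝ) ≤ L := by exact_mod_cast hL
  refine ⟨16 * c * L, 48 * c * L, by positivity, by positivity, ?_⟩
  intro K hK Λ V' ι' _ _ G' e x y hx hy hball
  have hK0 : 0 < K := lt_of_lt_of_le (by positivity) hK
  have hK16 : (16 : ℝ) ≤ K := le_trans (by nlinarith) hK
  have hK1 : (1 : ℝ) ≤ K := by linarith
  -- the trivial case `x = y`
  by_cases hne : x = y
  · subst hne
    have e1 : cosDiff (e.vmap ⟨x, hx⟩) (e.vmap ⟨x, hy⟩) = fun _ : V' → Circle => (1 : ℝ) :=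
      funext fun θ => cosDiff_self _ θ
    rw [e1, G'.villainExpect_one hK0]
    linarith [Real.sqrt_nonneg (48 * c * L * Real.log K / K)]
  -- frame and ensemble, pushed forward to `G'`
  obtain ⟨F, rfl, rfl⟩ := Frame.exists_of_ne hd hne
  set T : F.Rnd → G'.UnitChain (e.vmap ⟨F.x, hx⟩) (e.vmap ⟨F.y, hy⟩) :=
    fun s => (F.chainOf hx hy hball s).map e with hT
  set w : F.Rnd → ℝ := fun _ => (Fintype.card F.Rnd : ℝ)⁻¹ with hw
  haveI : Nonempty F.Rnd := ⟨fun _ => 0⟩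
  have hcard : (0 : ℝ) < Fintype.card F.Rnd := by exact_mod_cast Fintype.card_pos
  have hw0 : ∀ s, 0 ≤ w s := fun _ => by positivity
  have hw1 : ∑ s, w s = 1 := by
    rw [hw, Finset.sum_const, Finset.card_univ, nsmul_eq_mul, mul_inv_cancel₀ hcard.ne']
  -- the deterministic estimate on `G'`
  have hest := G'.one_sub_villainExpect_one_cosDiff_le hK0 (e.vmap ⟨F.x, hx⟩) (e.vmap ⟨F.y, hy⟩) w hw0 hw1 T
  -- `κ = λ_K^{-2} = e^{1/K}`, `ρ = κ^c`
  set κ : ℝ := ((villainMean K) ^ 2)⁻¹ with hκ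
  have hκ1 : 1 ≤ κ := by
    rw [hκ, inv_villainMean_sq]; exact Real.one_le_exp (by positivity)
  have hκle : κ ≤ (1 + 2 / K) ^ 2 := by
    have h := inv_villainMean_sq_le hK1
    have h1 : (1 : ℝ) ≤ 1 + 2 / K := le_add_of_nonneg_right (by positivity)
    calc κ ≤ 1 + 2 / K := h
      _ ≤ (1 + 2 / K) ^ 2 := by nlinarith
  set ρ : ℝ := κ ^ c with hρ
  have hρ1 : 1 ≤ ρ := one_le_pow₀ hκ1
  have hcK : 2 * ((2 * c : ℕ) : ℝ) ≤ K := by push_cast; nlinarith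
  have hcLK : 2 * ((2 * c * L : ℕ) : ℝ) ≤ K := by push_cast; nlinarith
  have hρle : ρ ≤ 1 + 8 * c / K := by
    calc ρ ≤ ((1 + 2 / K) ^ 2) ^ c := pow_le_pow_left₀ (by positivity) hκle c
      _ = (1 + 2 / K) ^ (2 * c) := by rw [← pow_mul]
      _ ≤ 1 + 4 * ((2 * c : ℕ) : ℝ) / K := one_add_two_div_pow_le hK0 hcK
      _ = 1 + 8 * c / K := by push_cast; ring
  have hρL : ρ ^ L ≤ 3 / 2 := by
    have h16 : 4 * ((2 * c * L : ℕ) : ℝ) / K ≤ 1 / 2 := by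
      rw [div_le_iff₀ hK0]; push_cast; nlinarith
    calc ρ ^ L ≤ (((1 + 2 / K) ^ 2) ^ c) ^ L :=
          pow_le_pow_left₀ (by positivity) (pow_le_pow_left₀ (by positivity) hκle c) L
      _ = (1 + 2 / K) ^ (2 * c * L) := by rw [← pow_mul, ← pow_mul]; simp only [hc]; ring_nf
      _ ≤ 1 + 4 * ((2 * c * L : ℕ) : ℝ) / K := one_add_two_div_pow_le hK0 hcLK
      _ ≤ 3 / 2 := by linarith
  -- the overlap moment (overlaps are preserved by the push-forward)
  have hmom : ∑ s, ∑ s', w s * w s' * κ ^ (T s).overlap (T s') ≤ 1 + 6 * L * (ρ - 1) := by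
    have hpair : ∀ s s', κ ^ (T s).overlap (T s') ≤
        ρ ^ meetCount (M F.T F.T) 0 (F.T + 1) ((s, s') : Pair F.T F.T) := by
      intro s s'
      rw [hρ, ← pow_mul]
      refine pow_le_pow_right₀ hκ1 ?_
      rw [hT]
      dsimp only
      rw [BondSystem.UnitChain.overlap_map]
      exact F.overlap_chainOf_le hx hy hball s s'
    have htail' := htail F.T F.T (Nat.lt_two_pow_self).le
    have hmgf := sum_pow_le_of_tails (fun p : Pair F.T F.T => meetCount (M F.T F.T) 0 (F.T + 1) p) hL
      (fun k => by simpa [DyadicWalk.cnt] using htail' k) hρ1 hρL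
    rw [Fintype.card_prod] at hmgf
    calc ∑ s, ∑ s', w s * w s' * κ ^ (T s).overlap (T s')
        ≤ ∑ s, ∑ s', w s * w s' * ρ ^ meetCount (M F.T F.T) 0 (F.T + 1) ((s, s') : Pair F.T F.T) :=
          Finset.sum_le_sum fun s _ => Finset.sum_le_sum fun s' _ =>
            mul_le_mul_of_nonneg_left (hpair s s') (mul_nonneg (hw0 s) (hw0 s'))
      _ = (Fintype.card F.Rnd : ℝ)⁻¹ ^ 2 * ∑ p : Pair F.T F.T, ρ ^ meetCount (M F.T F.T) 0 (F.T + 1) p := by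
          rw [Fintype.sum_prod_type, Finset.mul_sum]
          refine Finset.sum_congr rfl fun s _ => ?_
          rw [Finset.mul_sum]
          refine Finset.sum_congr rfl fun s' _ => ?_
          rw [hw]; ring
      _ ≤ (Fintype.card F.Rnd : ℝ)⁻¹ ^ 2 * ((1 + 6 * L * (ρ - 1)) * (Fintype.card F.Rnd * Fintype.card F.Rnd : ℕ)) :=
          mul_le_mul_of_nonneg_left hmgf (by positivity)
      _ = 1 + 6 * L * (ρ - 1) := by push_cast; field_simp
  -- conclusion
  have hfin : ∑ s, ∑ s', w s * w s' * κ ^ (T s).overlap (T s') - 1 ≤ 48 * c * L * Real.log K / K := by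
    have hlog : 1 ≤ Real.log K := by
      rw [← Real.log_exp 1]
      refine Real.log_le_log (Real.exp_pos 1) (le_trans ?_ hK16)
      linarith [Real.exp_one_lt_three]
    calc ∑ s, ∑ s', w s * w s' * κ ^ (T s).overlap (T s') - 1 ≤ 6 * L * (ρ - 1) := by linarith
      _ ≤ 6 * L * (8 * c / K) := mul_le_mul_of_nonneg_left (by linarith) (by positivity)
      _ = 48 * c * L * 1 / K := by ring
      _ ≤ 48 * c * L * Real.log K / K := by gcongr
  have hsq := Real.sqrt_le_sqrt hfin
  linarith [hest]

end Literature.Probability.LatticeModels
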